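import Mathlib
import Literature.NumberTheory.LFunctions.Zhang2022.Section16Eq169Mellin
import Literature.NumberTheory.LFunctions.Zhang2022.Section16AKappaTilde2Analytic
import Literature.NumberTheory.LFunctions.Zhang2022.Section16AEq1612Weighted
import HarnessLib

/-!
# Zhang (2022) §16 (16.10): the glue `u023 + [integral − residues estimate] ⇒ (16.10) (weighted)`

Topic `Literature/NumberTheory/LFunctions/Zhang2022` (Landau–Siegel audit tree; verdict-neutral).
Y. Zhang, *Discrete mean estimates and the Landau–Siegel zero*, arXiv:2211.02515v1 (2022)
[Zhang2022LandauSiegel] — **an unrefereed manuscript under adjudication** (ZHANG-L discharge lane, WP16,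
chain of the leaf `Typed.Section16A.Eq16_12 c′`). Display (16.10) [Z22 p. 92, tex L4550] ("In a way similar
to the proof of (15.15), by (16.9) we find that `𝒟₂(d,l) = λ₂(d)Σ_{j=1,2} ℛ₂ⱼ d^{β_j}ℳ₂(d,l;1−β_j) + O(ε₁)`")
is reached in two moves: u023 [tex L4545] rewrites `𝒟₂(d,l)` as `λ₂(d)·(1/2πi)∫_{(1)}[u023 integrand] + O(ε)`
(tree theorem `step16_u023_holds`, zl-libC-p5), and a contour shift bounds `(1/2πi)∫_{(1)} − Σ_j residues`
(zl-w16-p5's `Eq1610.*` files on the `GaussKernelContour` engine). This theorem-only file is the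
bookkeeping between the two and the consumer text of record (RT16-int-2 amended 2026-08-27: the hypothesis
`h10` of `eq16_12_of_eq16_5P_of_eq16_10_weighted`, weighted polynomial rate on the support of `b₁`,
coprimality of `l` only):

* `norm_lam2_one_le_prod` — `|λ₂(d,1)| ≤ ∏_{q∣d}(1 + 5/q)`; `prod_weight_abs_le`, `lam2_weight_absorb` —
  `|λ₂(d,1)|·|∏_{q∣dl}(1 + c₀q^{−9/10})| ≤ ∏_{q∣dl}(1 + (5 + 6|c₀|)q^{−9/10})`;
* `eq16_10W_of_integral_bound` — from `‖(1/2π)∫[u023 integrand](1+it)dt − Σ_j ℛ₂ⱼd^{β_j}ℳ₂(d,l;1−β_j)‖ ≤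
  C·∏_{q∣dl}(1 + c₀q^{−9/10})·𝓛⁻¹²⁰` (for `dl < 2T²P^{1/2}max(P₂,P₃)`, `(l,D) = 1`, under (A)) and u023, the
  (16.10) text of record (`exp(−c𝓛¹⁰) ≤ 𝓛⁻¹²⁰` eventually; `λ₂(d,1)` absorbed into the weight);
* `eq16_12_of_integral_bound` — composed with `eq16_12_of_eq16_5P_of_eq16_10_weighted` (given (16.5)ᴾ).

No new definitions, no named facts, no `sorry`; the integral estimate is a hypothesis, never asserted.
Nothing here bears on Theorems 1–2 of the source or on Landau–Siegel zeros.

## References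

* Y. Zhang, arXiv:2211.02515v1 (2022), §16 p. 92, u023 tex L4545, (16.10) tex L4550, (16.12) tex L4558.
  [cite: Zhang2022LandauSiegel, §16 (16.10) p.92]
-/

noncomputable section

open Complex Real
open Literature.NumberTheory.LFunctions.Zhang2022
open Literature.NumberTheory.LFunctions.Zhang2022.Skeleton
open Literature.NumberTheory.LFunctions.Zhang2022.Typed.Section16ALeaves

namespace Literature.NumberTheory.LFunctions.Zhang2022.Typed.Section16A

section Weights

variable (c' : ℝ) {D : ℕ} (χ : DirichletCharacter ℂ D)

/-- **`|λ₂(d,1)| ≤ ∏_{q∣d}(1 + 5/q)`** (`norm_lam2_le` at `s = 1`). [cite: Zhang2022LandauSiegel, §16 p.90 (u014)] -/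
theorem norm_lam2_one_le_prod (d : ℕ) :
    ‖lam2 c' χ d 1‖ ≤ ∏ q ∈ d.primeFactors, (1 + 5 * (q : ℝ)⁻¹) := by
  have h := norm_lam2_le c' χ d (s := 1) (by norm_num)
  simpa only [Complex.one_re, Real.rpow_neg_one] using h

/-- `|∏_{q∣n}(1 + c₀q^{−9/10})| ≤ ∏_{q∣n}(1 + |c₀|q^{−9/10})`. [folklore] -/
private theorem prod_weight_abs_le (c₀ : ℝ) (n : ℕ) :
    |∏ q ∈ n.primeFactors, (1 + c₀ / (q : ℝ) ^ (9 / 10 : ℝ))| ≤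
      ∏ q ∈ n.primeFactors, (1 + |c₀| / (q : ℝ) ^ (9 / 10 : ℝ)) := by
  rw [Finset.abs_prod]
  refine Finset.prod_le_prod (fun q _ => abs_nonneg _) fun q hq => ?_
  have hq9 : 0 < (q : ℝ) ^ (9 / 10 : ℝ) := by
    have : (0 : ℝ) < q := by exact_mod_cast (Nat.prime_of_mem_primeFactors hq).pos
    positivity
  calc |1 + c₀ / (q : ℝ) ^ (9 / 10 : ℝ)| ≤ |(1 : ℝ)| + |c₀ / (q : ℝ) ^ (9 / 10 : ℝ)| := abs_add_le _ _
    _ = 1 + |c₀| / (q : ℝ) ^ (9 / 10 : ℝ) := by rw [abs_one, abs_div, abs_of_pos hq9]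

/-- **Absorbing `λ₂(d,1)` into the Euler weight**: for `d, l ≥ 1`,
`|λ₂(d,1)|·|∏_{q∣dl}(1 + c₀q^{−9/10})| ≤ ∏_{q∣dl}(1 + (5 + 6|c₀|)q^{−9/10})`
(`1/q ≤ q^{−9/10}`, `(1+5x)(1+|c₀|x) ≤ 1 + (5 + 6|c₀|)x` for `0 ≤ x ≤ 1`, primes of `d` among those of
`dl`). [cite: Zhang2022LandauSiegel, §16 (16.10) p.92] -/
theorem lam2_weight_absorb (c₀ : ℝ) {d l : ℕ} (hd : d ≠ 0) (hl : l ≠ 0) :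
    ‖lam2 c' χ d 1‖ * |∏ q ∈ (d * l).primeFactors, (1 + c₀ / (q : ℝ) ^ (9 / 10 : ℝ))| ≤
      ∏ q ∈ (d * l).primeFactors, (1 + (5 + 6 * |c₀|) / (q : ℝ) ^ (9 / 10 : ℝ)) := by
  have hc : 0 ≤ |c₀| := abs_nonneg _
  -- `|λ₂(d,1)| ≤ ∏_{q∣dl}(1 + 5q^{−9/10})`
  have h1 : ‖lam2 c' χ d 1‖ ≤ ∏ q ∈ (d * l).primeFactors, (1 + 5 / (q : ℝ) ^ (9 / 10 : ℝ)) := by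
    refine (norm_lam2_one_le_prod c' χ d).trans ?_
    have hsub : d.primeFactors ⊆ (d * l).primeFactors := by
      rw [Nat.primeFactors_mul hd hl]; exact Finset.subset_union_left
    calc ∏ q ∈ d.primeFactors, (1 + 5 * (q : ℝ)⁻¹)
        ≤ ∏ q ∈ d.primeFactors, (1 + 5 / (q : ℝ) ^ (9 / 10 : ℝ)) := by
          refine Finset.prod_le_prod (fun q _ => by positivity) fun q hq => ?_
          have hq1 : (1 : ℝ) ≤ q := by exact_mod_cast (Nat.prime_of_mem_primeFactors hq).one_le
          have hq0 : (0 : ℝ) < q := by linarith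
          have : (q : ℝ) ^ (9 / 10 : ℝ) ≤ (q : ℝ) ^ (1 : ℝ) :=
            Real.rpow_le_rpow_of_exponent_le hq1 (by norm_num)
          rw [Real.rpow_one] at this
          have h9 : 0 < (q : ℝ) ^ (9 / 10 : ℝ) := by positivity
          rw [← div_eq_mul_inv]
          gcongr
      _ ≤ ∏ q ∈ (d * l).primeFactors, (1 + 5 / (q : ℝ) ^ (9 / 10 : ℝ)) :=
          Finset.prod_le_prod_of_subset_of_one_le hsub (fun q _ => by positivity) fun q _ _ => by
            have : (0 : ℝ) ≤ 5 / (q : ℝ) ^ (9 / 10 : ℝ) := by positivity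
            linarith
  refine (mul_le_mul h1 (prod_weight_abs_le c₀ (d * l)) (abs_nonneg _)
    (Finset.prod_nonneg fun q _ => by positivity)).trans ?_
  rw [← Finset.prod_mul_distrib]
  refine Finset.prod_le_prod (fun q _ => by positivity) fun q hq => ?_
  have hq1 : (1 : ℝ) ≤ q := by exact_mod_cast (Nat.prime_of_mem_primeFactors hq).one_le
  set x : ℝ := 1 / (q : ℝ) ^ (9 / 10 : ℝ) with hx
  have hx0 : 0 ≤ x := by positivity
  have hx1 : x ≤ 1 := by
    rw [hx, div_le_one (by positivity)]
    exact Real.one_le_rpow hq1 (by norm_num)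
  have e1 : 1 + 5 / (q : ℝ) ^ (9 / 10 : ℝ) = 1 + 5 * x := by rw [hx]; ring
  have e2 : 1 + |c₀| / (q : ℝ) ^ (9 / 10 : ℝ) = 1 + |c₀| * x := by rw [hx]; ring
  have e3 : 1 + (5 + 6 * |c₀|) / (q : ℝ) ^ (9 / 10 : ℝ) = 1 + (5 + 6 * |c₀|) * x := by rw [hx]; ring
  rw [e1, e2, e3]
  nlinarith [mul_nonneg hc hx0, mul_le_mul_of_nonneg_left hx1 (mul_nonneg hc hx0)]

end Weights

section Main

variable (c' : ℝ)

/-- **(16.10) (weighted, on the support of `b₁`) ⇐ u023 + the contour estimate of the u023 integral.**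
From `‖(1/2π)∫[u023 integrand](1+it)dt − Σ_{j=1,2} ℛ₂ⱼ d^{β_j}ℳ₂(d,l;1−β_j)‖ ≤ C·∏_{q∣dl}(1+c₀q^{−9/10})·𝓛⁻¹²⁰`
for `d, l ≥ 1`, `dl < 2T²P^{1/2}max(P₂,P₃)`, `(l,D) = 1` (under (A)), and u023 (`step16_u023_holds`:
`𝒟₂(d,l) = λ₂(d)·(1/2π)∫ + O(e^{−c𝓛¹⁰})` for `dl < P`), the text of record of (16.10):
`‖𝒟₂(d,l) − λ₂(d)Σ_j ℛ₂ⱼd^{β_j}ℳ₂(d,l;1−β_j)‖ ≤ C′·∏_{q∣dl}(1+(5+6|c₀|)q^{−9/10})·𝓛⁻¹²⁰`.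
[cite: Zhang2022LandauSiegel, §16 (16.10) p.92] -/
theorem eq16_10W_of_integral_bound
    (hI : ∃ c₀ C : ℝ, ForAllLarge fun D _ χ => AssumptionA D χ →
      ∀ d l : ℕ, 1 ≤ d → 1 ≤ l →
        ((d * l : ℕ) : ℝ) < 2 * bigT D ^ 2 * (bigP D ^ (1 / 2 : ℝ) * max (Skeleton.P2 D) (P3 D)) →
        Nat.Coprime l D →
        ‖(1 / (2 * π) : ℂ) * (∫ t : ℝ, integrand16_u023 c' χ d l (1 + t * I)) -
            ∑ j ∈ ({1, 2} : Finset ℕ),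
              calR2 c' χ j * (d : ℂ) ^ betaJ c' D j * calM2 c' χ d l (1 - betaJ c' D j)‖ ≤
          C * (∏ q ∈ (d * l).primeFactors, (1 + c₀ / (q : ℝ) ^ (9 / 10 : ℝ))) * (ell D ^ 120)⁻¹) :
    ∃ c₀ C : ℝ, ForAllLarge fun D _ χ => AssumptionA D χ →
      ∀ d l : ℕ, 1 ≤ d → 1 ≤ l →
        ((d * l : ℕ) : ℝ) < 2 * bigT D ^ 2 * (bigP D ^ (1 / 2 : ℝ) * max (Skeleton.P2 D) (P3 D)) →
        Nat.Coprime l D →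
        ‖calD2 c' χ d l - lam2 c' χ d 1 * ∑ j ∈ ({1, 2} : Finset ℕ),
            calR2 c' χ j * (d : ℂ) ^ betaJ c' D j * calM2 c' χ d l (1 - betaJ c' D j)‖ ≤
          C * (∏ q ∈ (d * l).primeFactors, (1 + c₀ / (q : ℝ) ^ (9 / 10 : ℝ))) * (ell D ^ 120)⁻¹ := by
  obtain ⟨c₀, C, hI'⟩ := hI
  obtain ⟨c, hc, C₂₃, h23⟩ := step16_u023_holds c'
  -- constants: `c₀' = 5 + 6|c₀|`, `C' = |C| + |C₂₃|`
  refine ⟨5 + 6 * |c₀|, |C| + |C₂₃|, ?_⟩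
  obtain ⟨D₁, h₁⟩ := hI'.and h23
  -- `exp(−c𝓛¹⁰)·𝓛¹²⁰ ≤ 1` eventually: `𝓛¹²⁰ ≤ (120/c)¹²⁰·... `; use `x¹²⁰/120! ≤ eˣ` with `x = c𝓛¹⁰ ≥ c𝓛`
  obtain ⟨D₂, hD₂⟩ := exists_forall_le_ell (max 10 ((Nat.factorial 120 : ℝ) / c ^ 120 + 1))
  refine ⟨max D₁ D₂, fun D _ χ hD hq hp hA d l hd hl hdl hcop => ?_⟩
  have hD₁ : D₁ ≤ D := le_trans (le_max_left _ _) hD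
  have hℓM := hD₂ D (le_trans (le_max_right _ _) hD)
  have hℓ10 : 10 ≤ ell D := le_trans (le_max_left _ _) hℓM
  have hℓF : (Nat.factorial 120 : ℝ) / c ^ 120 + 1 ≤ ell D := le_trans (le_max_right _ _) hℓM
  have hℓ1 : 1 ≤ ell D := by linarith
  have hℓ0 : 0 < ell D := by linarith
  obtain ⟨eI, e23⟩ := h₁ D χ hD₁ hq hp
  have hd0 : d ≠ 0 := by omega
  have hl0 : l ≠ 0 := by omega
  -- ranges
  have hdlP : ((d * l : ℕ) : ℝ) < bigP D := lt_of_lt_of_le hdl (suppBound_le_bigP hℓ10)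
  have hIdl := eI hA d l hd hl hdl hcop
  have h23dl := e23 hA d l hd hl hdlP
  -- abbreviations
  set Iint : ℂ := (1 / (2 * π) : ℂ) * ∫ t : ℝ, integrand16_u023 c' χ d l (1 + t * I) with hIint
  set Sres : ℂ := ∑ j ∈ ({1, 2} : Finset ℕ),
      calR2 c' χ j * (d : ℂ) ^ betaJ c' D j * calM2 c' χ d l (1 - betaJ c' D j) with hSres
  set W : ℝ := ∏ q ∈ (d * l).primeFactors, (1 + c₀ / (q : ℝ) ^ (9 / 10 : ℝ)) with hW
  set W' : ℝ := ∏ q ∈ (d * l).primeFactors, (1 + (5 + 6 * |c₀|) / (q : ℝ) ^ (9 / 10 : ℝ)) with hW'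
  set r : ℝ := (ell D ^ 120)⁻¹ with hr
  have hr0 : 0 < r := by positivity
  have hW'1 : 1 ≤ W' := by
    have h := Finset.prod_le_prod_of_subset_of_one_le (f := fun q : ℕ => 1 + (5 + 6 * |c₀|) / (q : ℝ) ^ (9 / 10 : ℝ))
      (Finset.empty_subset (d * l).primeFactors) (fun q hq => absurd hq (Finset.notMem_empty q))
      fun q _ _ => by
        have : (0 : ℝ) ≤ (5 + 6 * |c₀|) / (q : ℝ) ^ (9 / 10 : ℝ) := by positivity
        linarith
    simpa only [Finset.prod_empty] using h
  have hW'0 : 0 ≤ W' := le_trans zero_le_one hW'1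
  -- the two pieces
  have hA1 : ‖calD2 c' χ d l - lam2 c' χ d 1 * Iint‖ ≤ C₂₃ * Real.exp (-c * ell D ^ 10) := h23dl
  have hA2 : ‖Iint - Sres‖ ≤ C * W * r := hIdl
  have hsplit : calD2 c' χ d l - lam2 c' χ d 1 * Sres =
      (calD2 c' χ d l - lam2 c' χ d 1 * Iint) + lam2 c' χ d 1 * (Iint - Sres) := by ring
  -- `λ₂(d,1)·C·W·r ≤ |C|·W'·r`
  have hB2 : ‖lam2 c' χ d 1 * (Iint - Sres)‖ ≤ |C| * W' * r := by
    rw [norm_mul]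
    calc ‖lam2 c' χ d 1‖ * ‖Iint - Sres‖ ≤ ‖lam2 c' χ d 1‖ * (C * W * r) :=
          mul_le_mul_of_nonneg_left hA2 (norm_nonneg _)
      _ ≤ ‖lam2 c' χ d 1‖ * |C * W * r| := mul_le_mul_of_nonneg_left (le_abs_self _) (norm_nonneg _)
      _ = |C| * (‖lam2 c' χ d 1‖ * |W|) * r := by rw [abs_mul, abs_mul, abs_of_pos hr0]; ring
      _ ≤ |C| * W' * r := by
          have h := lam2_weight_absorb c' χ c₀ hd0 hl0
          exact mul_le_mul_of_nonneg_right (mul_le_mul_of_nonneg_left h (abs_nonneg _)) hr0.le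
  -- `C₂₃ e^{−c𝓛¹⁰} ≤ |C₂₃|·W'·r`: `𝓛¹²⁰ ≤ e^{c𝓛¹⁰}`
  have hexp : Real.exp (-c * ell D ^ 10) ≤ r := by
    rw [hr, show (-c * ell D ^ 10) = -(c * ell D ^ 10) by ring, Real.exp_neg]
    refine inv_anti₀ (by positivity) ?_
    have hf := Real.pow_div_factorial_le_exp (c * ell D ^ 10) (by positivity) 120
    refine le_trans ?_ hf
    rw [le_div_iff₀ (by positivity), mul_pow]
    -- `𝓛¹²⁰·120! ≤ c¹²⁰ (𝓛¹⁰)¹²⁰`: from `120!/c¹²⁰ + 1 ≤ 𝓛 ≤ 𝓛¹⁰⁸⁰`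
    have hc120 : 0 < c ^ 120 := by positivity
    have h1 : (Nat.factorial 120 : ℝ) ≤ c ^ 120 * ell D := by
      have := (div_le_iff₀' hc120).mp (by linarith : (Nat.factorial 120 : ℝ) / c ^ 120 ≤ ell D)
      linarith
    have h2 : ell D ≤ ell D ^ 1080 := le_self_pow₀ hℓ1 (by norm_num)
    calc ell D ^ 120 * (Nat.factorial 120 : ℝ) ≤ ell D ^ 120 * (c ^ 120 * ell D ^ 1080) := by
          refine mul_le_mul_of_nonneg_left (h1.trans ?_) (by positivity)
          exact mul_le_mul_of_nonneg_left h2 hc120.le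
      _ = c ^ 120 * (ell D ^ 10) ^ 120 := by ring
  have hB1 : ‖calD2 c' χ d l - lam2 c' χ d 1 * Iint‖ ≤ |C₂₃| * W' * r := by
    refine hA1.trans ?_
    calc C₂₃ * Real.exp (-c * ell D ^ 10) ≤ |C₂₃| * Real.exp (-c * ell D ^ 10) :=
          mul_le_mul_of_nonneg_right (le_abs_self _) (Real.exp_pos _).le
      _ ≤ |C₂₃| * r := mul_le_mul_of_nonneg_left hexp (abs_nonneg _)
      _ = |C₂₃| * 1 * r := by ring
      _ ≤ |C₂₃| * W' * r :=
          mul_le_mul_of_nonneg_right (mul_le_mul_of_nonneg_left hW'1 (abs_nonneg _)) hr0.le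
  rw [hsplit]
  calc ‖calD2 c' χ d l - lam2 c' χ d 1 * Iint + lam2 c' χ d 1 * (Iint - Sres)‖
      ≤ ‖calD2 c' χ d l - lam2 c' χ d 1 * Iint‖ + ‖lam2 c' χ d 1 * (Iint - Sres)‖ := norm_add_le _ _
    _ ≤ |C₂₃| * W' * r + |C| * W' * r := add_le_add hB1 hB2
    _ = (|C| + |C₂₃|) * W' * r := by ring

/-- **(16.12) ⇐ (16.5)ᴾ + the contour estimate of the u023 integral** — the composition
`eq16_12_of_eq16_5P_of_eq16_10_weighted ∘ eq16_10W_of_integral_bound`.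
[cite: Zhang2022LandauSiegel, §16 (16.12) p.92] -/
theorem eq16_12_of_eq16_5P_of_integral_bound (h5 : Eq16_5P c')
    (hI : ∃ c₀ C : ℝ, ForAllLarge fun D _ χ => AssumptionA D χ →
      ∀ d l : ℕ, 1 ≤ d → 1 ≤ l →
        ((d * l : ℕ) : ℝ) < 2 * bigT D ^ 2 * (bigP D ^ (1 / 2 : ℝ) * max (Skeleton.P2 D) (P3 D)) →
        Nat.Coprime l D →
        ‖(1 / (2 * π) : ℂ) * (∫ t : ℝ, integrand16_u023 c' χ d l (1 + t * I)) -
            ∑ j ∈ ({1, 2} : Finset ℕ),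
              calR2 c' χ j * (d : ℂ) ^ betaJ c' D j * calM2 c' χ d l (1 - betaJ c' D j)‖ ≤
          C * (∏ q ∈ (d * l).primeFactors, (1 + c₀ / (q : ℝ) ^ (9 / 10 : ℝ))) * (ell D ^ 120)⁻¹) :
    Eq16_12 c' :=
  eq16_12_of_eq16_5P_of_eq16_10_weighted c' h5 (eq16_10W_of_integral_bound c' hI)

/-- **The same glue with any polynomial rate `𝓛⁻ᵏ`, `k ≥ 120`, and WITHOUT the coprimality restriction
being used** — the shape zl-w16-p5's Theorem A delivers (`(ell D ^ 2000)⁻¹`): monotonicity `𝓛⁻ᵏ ≤ 𝓛⁻¹²⁰`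
for `𝓛 ≥ 1`, then `eq16_10W_of_integral_bound`. [cite: Zhang2022LandauSiegel, §16 (16.10) p.92] -/
theorem eq16_10W_of_integral_bound_pow (k : ℕ) (hk : 120 ≤ k)
    (hI : ∃ c₀ C : ℝ, ForAllLarge fun D _ χ => AssumptionA D χ →
      ∀ d l : ℕ, 1 ≤ d → 1 ≤ l →
        ((d * l : ℕ) : ℝ) < 2 * bigT D ^ 2 * (bigP D ^ (1 / 2 : ℝ) * max (Skeleton.P2 D) (P3 D)) →
        ‖(1 / (2 * π) : ℂ) * (∫ t : ℝ, integrand16_u023 c' χ d l (1 + t * I)) -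
            ∑ j ∈ ({1, 2} : Finset ℕ),
              calR2 c' χ j * (d : ℂ) ^ betaJ c' D j * calM2 c' χ d l (1 - betaJ c' D j)‖ ≤
          C * (∏ q ∈ (d * l).primeFactors, (1 + c₀ / (q : ℝ) ^ (9 / 10 : ℝ))) * (ell D ^ k)⁻¹) :
    ∃ c₀ C : ℝ, ForAllLarge fun D _ χ => AssumptionA D χ →
      ∀ d l : ℕ, 1 ≤ d → 1 ≤ l →
        ((d * l : ℕ) : ℝ) < 2 * bigT D ^ 2 * (bigP D ^ (1 / 2 : ℝ) * max (Skeleton.P2 D) (P3 D)) →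
        Nat.Coprime l D →
        ‖calD2 c' χ d l - lam2 c' χ d 1 * ∑ j ∈ ({1, 2} : Finset ℕ),
            calR2 c' χ j * (d : ℂ) ^ betaJ c' D j * calM2 c' χ d l (1 - betaJ c' D j)‖ ≤
          C * (∏ q ∈ (d * l).primeFactors, (1 + c₀ / (q : ℝ) ^ (9 / 10 : ℝ))) * (ell D ^ 120)⁻¹ := by
  obtain ⟨c₀, C, hI'⟩ := hI
  refine eq16_10W_of_integral_bound c' ⟨|c₀|, |C|, ?_⟩
  obtain ⟨D₁, h₁⟩ := hI'
  obtain ⟨D₂, hD₂⟩ := exists_forall_le_ell (1 : ℝ)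
  refine ⟨max D₁ D₂, fun D _ χ hD hq hp hA d l hd hl hdl _ => ?_⟩
  have hℓ1 : 1 ≤ ell D := hD₂ D (le_trans (le_max_right _ _) hD)
  have h := h₁ D χ (le_trans (le_max_left _ _) hD) hq hp hA d l hd hl hdl
  refine h.trans ?_
  -- `C·W·𝓛⁻ᵏ ≤ |C|·|W|·𝓛⁻ᵏ ≤ |C|·W_{|c₀|}·𝓛⁻¹²⁰`
  have hk0 : 0 < (ell D ^ k)⁻¹ := by positivity
  have hW := prod_weight_abs_le c₀ (d * l)
  have hW0 : 0 ≤ ∏ q ∈ (d * l).primeFactors, (1 + |c₀| / (q : ℝ) ^ (9 / 10 : ℝ)) :=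
    Finset.prod_nonneg fun q _ => by positivity
  have hpow : (ell D ^ k)⁻¹ ≤ (ell D ^ 120)⁻¹ :=
    inv_anti₀ (by positivity) (pow_le_pow_right₀ hℓ1 hk)
  calc C * (∏ q ∈ (d * l).primeFactors, (1 + c₀ / (q : ℝ) ^ (9 / 10 : ℝ))) * (ell D ^ k)⁻¹
      ≤ |C * (∏ q ∈ (d * l).primeFactors, (1 + c₀ / (q : ℝ) ^ (9 / 10 : ℝ))) * (ell D ^ k)⁻¹| :=
        le_abs_self _
    _ = |C| * |∏ q ∈ (d * l).primeFactors, (1 + c₀ / (q : ℝ) ^ (9 / 10 : ℝ))| * (ell D ^ k)⁻¹ := by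
        rw [abs_mul, abs_mul, abs_of_pos hk0]
    _ ≤ |C| * (∏ q ∈ (d * l).primeFactors, (1 + |c₀| / (q : ℝ) ^ (9 / 10 : ℝ))) * (ell D ^ 120)⁻¹ :=
        mul_le_mul (mul_le_mul_of_nonneg_left hW (abs_nonneg _)) hpow hk0.le (mul_nonneg (abs_nonneg _) hW0)

/-- **(16.12) ⇐ (16.5)ᴾ + the contour estimate with any rate `𝓛⁻ᵏ`, `k ≥ 120`.**
[cite: Zhang2022LandauSiegel, §16 (16.12) p.92] -/
theorem eq16_12_of_eq16_5P_of_integral_bound_pow (h5 : Eq16_5P c') (k : ℕ) (hk : 120 ≤ k)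
    (hI : ∃ c₀ C : ℝ, ForAllLarge fun D _ χ => AssumptionA D χ →
      ∀ d l : ℕ, 1 ≤ d → 1 ≤ l →
        ((d * l : ℕ) : ℝ) < 2 * bigT D ^ 2 * (bigP D ^ (1 / 2 : ℝ) * max (Skeleton.P2 D) (P3 D)) →
        ‖(1 / (2 * π) : ℂ) * (∫ t : ℝ, integrand16_u023 c' χ d l (1 + t * I)) -
            ∑ j ∈ ({1, 2} : Finset ℕ),
              calR2 c' χ j * (d : ℂ) ^ betaJ c' D j * calM2 c' χ d l (1 - betaJ c' D j)‖ ≤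
          C * (∏ q ∈ (d * l).primeFactors, (1 + c₀ / (q : ℝ) ^ (9 / 10 : ℝ))) * (ell D ^ k)⁻¹) :
    Eq16_12 c' :=
  eq16_12_of_eq16_5P_of_eq16_10_weighted c' h5 (eq16_10W_of_integral_bound_pow c' k hk hI)

end Main


end Literature.NumberTheory.LFunctions.Zhang2022.Typed.Section16A
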